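import Literature.AlgebraicGeometry.HodgeTheory.FermatShiodaCondition

/-!
# Exotic ∕ accidental Hodge pairs on squares of Fermat surfaces — the dictionary (definitions)

Chapter «EXO» of cell hodge-nonav (planner p1 g31, memo `ROUTE-P1AD` §A, Sketch `ROUTE-P1AD-Sketch.lean` sha16
2efe8a64077626f5, `namespace HodgeNonAV.P1AD`), landed as tree definitions (ask A36-a). All definitions are
bookkeeping over the tree's `FermatCharacter.IsHodgeMultiset` (Shioda's semigroup `Mₘ`); the theorems about them
(EXO-1 `fermatSep_prime`, the kernel-certified accidental pairs, the `ξ₃₅` identification) live in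
`Theorems/FermatSurfaceExoticPairs`.

DICTIONARY (`S = Sₘ = X²ₘ` the Fermat surface of degree `m`, `T = T(S)` its transcendental `ℚ`-Hodge structure,
`V(u) ⊂ H²_prim(S, ℂ)` the eigenline of the character `u = (u₀,u₁,u₂,u₃) ∈ 𝔘²ₘ`, i.e. `uᵢ ≠ 0`, `∑ uᵢ = 0`;
`V(u) ⊂ H^{1,1}` iff `u ∈ 𝔅²ₘ` iff the value multiset `{u}` `IsHodgeMultiset`; `V(u) ⊂ T ⊗ ℂ` iff `u` is
TRANSCENDENTAL = admissible and not Hodge, `IsTransQuad`):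
* the Hodge classes in `T ⊗ T ⊂ H⁴(S × S, ℚ)` are spanned over `ℂ` by the lines `V(u) ⊗ V(u')` with the OCTUPLE
  `u ∗ u'` a Hodge character of `X⁶ₘ` (type `(2,2)` after every Galois twist `t ∈ (ℤ/m)ˣ`); writing `w = −u'`
  (`V(−w) = conj V(w) ≅ V(w)^∨`) such a line is a Hodge ISOMORPHISM PIECE `Hom(V[w], V[u])`: `IsHodgePair u w`;
* `w` a coordinate permutation of `u` (`w = u` as multisets): the line is spanned by Künneth components of graphs
  of automorphisms `g ∈ μₘ⁴/μₘ ⋊ 𝔖₄` — algebraic; these exhaust the Hodge pairs iff `FermatSep m` (⟺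
  `End_Hdg(T(Sₘ)) = span_ℚ Aut(Sₘ)^*|_T`, the hypothesis shape of the landed SQ-AUT
  `PgOneCyclotomicSquares.hodgeConjectureFor_square_of_endomorphisms` ⟹ `HC⁴(Sₘ × Sₘ)`);
* `w ≠ u`: an EXOTIC pair (`IsExoticPair`) = an accidental isomorphism of `ℚ`-Hodge structures between CM pieces
  of `H²(Sₘ)` (`IsAccidentalPair`) or, for `w = t·u` a Galois twist, a non-primitive CM type;
* `FermatSepCriterion m`: the right-hand side of the conjectured separation law EXO-2 «`FermatSep m ↔
  FermatSepCriterion m` for `m ≥ 2`» (census-exact for `2 ≤ m ≤ 120`; the law itself is a CONJECTURE of the memo,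
  recorded in the docstring only — NOT proved and NOT used as a hypothesis anywhere).

Prover seat hodge-nonav-19716-p2 g0 (`--supports stmt-HodgeConjecture-19652`, helper). Definitions only; no
instance, no notation, no sorry. Nothing here bears on the Hodge conjecture by itself.

References: Shioda, *The Hodge conjecture for Fermat varieties*, Math. Ann. 245 (1979) §1 eq. (2), §2 Thm. 1;
N. Aoki, *On some arithmetic problems related to the Hodge cycles on the Fermat varieties*, Math. Ann. 266
(1983) §5, Thm. D; G. da Silva Jr., *On the Hodge conjecture for Fermat varieties* (arXiv:2101.04739, 2021)
Thm. 2.1, 2.2, Cor. 2.3; Ran, *Cycles on Fermat hypersurfaces*, Compositio Math. 42 (1980) Prop. 1.8.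
-/

set_option linter.dupNamespace false

namespace Summit.HodgeConjecture.HodgeConjecture.Theorems.FermatSurfaceExoticPairs

open Multiset Literature.AlgebraicGeometry.HodgeTheory
open Literature.AlgebraicGeometry.HodgeTheory.FermatCharacter

variable {m : ℕ}

/-- `u` is (the value multiset of) a TRANSCENDENTAL character of the Fermat surface `X²ₘ`: four non-zero
residues with zero sum (`u ∈ 𝔘²ₘ`, `V(u) ≠ 0` in `H²_prim`) which is NOT a Hodge multiset (`V(u) ⊄ H^{1,1}`, i.e.
`V(u) ⊂ T(X²ₘ) ⊗ ℂ`). [cite: Shioda1979PJA, §1] [cite: daSilva2021HodgeFermat, Thm. 2.1] -/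
def IsTransQuad (u : Multiset (ZMod m)) : Prop :=
  card u = 4 ∧ (∀ a ∈ u, a ≠ 0) ∧ u.sum = 0 ∧ ¬ IsHodgeMultiset u

/-- The negated multiset `−w` (the character of the complex-conjugate ∕ dual eigenline). [folklore] -/
def negM (w : Multiset (ZMod m)) : Multiset (ZMod m) := w.map fun a ↦ -a

/-- HODGE PAIR `(u, w)` on `X²ₘ × X²ₘ`: `u, w` transcendental and the octuple `u ∗ (−w)` is a Hodge character of
`X⁶ₘ` — equivalently `⟨tu⟩ = ⟨tw⟩` for every unit `t` (same Hodge type after every Galois twist), equivalently the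
line `V(u) ⊗ V(−w) = Hom(V(w), V(u)) ⊂ H⁴(X²ₘ × X²ₘ, ℂ)` is of type `(2,2)` together with all its conjugates, i.e. lies
in the complexification of the space of Hodge classes. [cite: Shioda1979PJA, §1 eq. (2)]
[cite: daSilva2021HodgeFermat, Thm. 2.1 (b), Thm. 2.2] -/
def IsHodgePair (u w : Multiset (ZMod m)) : Prop :=
  IsTransQuad u ∧ IsTransQuad w ∧ IsHodgeMultiset (u + negM w)

/-- EXOTIC pair: a Hodge pair which is not a coordinate permutation (`w ≠ u` as multisets) — its class is NOT in
the span of the Künneth components of graphs of automorphisms `μₘ⁴/μₘ ⋊ 𝔖₄`. [cell hodge-nonav memo ROUTE-P1AD §A] -/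
def IsExoticPair (u w : Multiset (ZMod m)) : Prop :=
  IsHodgePair u w ∧ u ≠ w

/-- ACCIDENTAL (non-Galois exotic) pair: moreover `w` is not a unit multiple `t • u` — an accidental isomorphism
`V[u] ≅ V[w]` between two DIFFERENT Galois-orbit pieces of `H²(X²ₘ, ℚ)` (the Galois-twist pairs `(u, t•u)` are the
non-primitive CM types, failures of the separation condition of `Theorems/SeparatedCyclotomicSelfMapSquareHodge`).
[cell hodge-nonav memo ROUTE-P1AD §A] -/
def IsAccidentalPair (u w : Multiset (ZMod m)) : Prop :=
  IsHodgePair u w ∧ ∀ t : (ZMod m)ˣ, u.map (fun a ↦ (t : ZMod m) * a) ≠ w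

/-- SHARED-COORDINATE pair: `u` and `w` have a common value `c`; then `(u − c) # (−(w − c))` is a Hodge SEXTUPLE,
a Hodge class on the Fermat FOURFOLD `X⁴ₘ` (da Silva's `#`), and the pair class is algebraic iff that fourfold class
is (μₘ-invariant transfer, `π^* π_* = m`). Pairs WITHOUT shared coordinate are invisible on `X⁴ₘ`.
[cite: daSilva2021HodgeFermat, Thm. 2.2, Cor. 2.3 (b)] -/
def SharesCoordinate (u w : Multiset (ZMod m)) : Prop := ∃ c ∈ u, c ∈ w

/-- FERMAT-SEP_m: the Fermat surface of degree `m` has NO exotic pairs — every Hodge pair is a coordinate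
permutation; ⟹ `End_Hdg(T(X²ₘ)) = span Aut^*` ⟹ `HC⁴(X²ₘ × X²ₘ)` by SQ-AUT. Census (memo ROUTE-P1AD §C): for
`4 ≤ m ≤ 120` it holds iff `m` is prime or `m ∈ {4, 49, 77, 91, 119}`. [cell hodge-nonav memo ROUTE-P1AD §C] -/
def FermatSep (m : ℕ) : Prop := ∀ u w : Multiset (ZMod m), IsHodgePair u w → u = w

/-- The conjectured separation criterion of EXO-2: `m` prime, or `m = 4`, or `m` odd with every prime factor `≥ 7`
(for `m ≤ 120`: primes ∪ {1, 4, 49, 77, 91, 119}; `m = 1, 2, 3` are vacuous — no transcendental characters).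
**EXO-2 (CONJECTURE of the cell memo ROUTE-P1AD §B — NOT proved here, NOT a hypothesis of any tree theorem):**
`∀ m ≥ 2, FermatSep m ↔ FermatSepCriterion m`. The direction `→` is witnessed for the smallest failing degrees
by explicit exotic pairs (`Theorems/FermatSurfaceExoticPairs`: `not_fermatSep_6 ∕ 8 ∕ 9 ∕ 15 ∕ 21 ∕ 25 ∕ 35`); the
direction `←` is `fermatSep_prime` for primes and OPEN (census-verified for `m ≤ 120`, kit j290871 ∕ j291259) for
`4, 49, 77, 91, 119, …`. Mechanism: an exotic pair is an 8-term ℤ-relation among the sawtooth values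
`t ↦ ⟨ta/m⟩` not generated by oddness; by Bass–Kubert such relations come from the distribution identities, whose
shortest instances are Aoki's standard characters `σ_{p,a}` with `p + 1` terms (Aoki 1983 §5 Prop. 5.1, Thm. D).
[cell hodge-nonav memo ROUTE-P1AD §B; conjecture] -/
def FermatSepCriterion (m : ℕ) : Prop :=
  m.Prime ∨ m = 4 ∨ (Odd m ∧ ∀ p : ℕ, p.Prime → p ∣ m → 7 ≤ p)


end Summit.HodgeConjecture.HodgeConjecture.Theorems.FermatSurfaceExoticPairs
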